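import Literature.NumberTheory.EllipticCurves.TunnellThetaCoefficients
import Literature.NumberTheory.EllipticCurves.CongruentNumberCurveSupersingular
import Mathlib.NumberTheory.SumTwoSquares
import HarnessLib

/-!
# The supersingular half of the Shimura–Niwa input for `g θ₈`: `d₈(p²) = 1` and
# `λ_p(g θ₈) = 0 = a_p(E)` for primes `p ≡ 3 (mod 4)`

In the proof of Theorem 2 of Tunnell 1983 (pp. 327–328) the identification of the
`T(p²)`-eigenvalues of `g θ₈` with `a_p(E)`, `E : y² = x³ - x`, comes from Shimura's main theorem
and Niwa's level bound. Once `g θ₈` is known to be an eigenform (the tree's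
`heckeTSq_tunnellForm_eight_eq_smul`, unconditional after the basis theorem of
`TunnellWeightThreeHalvesBasisProofs`), the eigenvalue is the coefficient of `q¹` of
`T(p²)(g θ₈)`, i.e. `λ_p = d₈(p²) + (-1/p)` with `g θ₈ = ∑ d₈(n) qⁿ`,
`d₈(n) = ∑_{(4m+1)² + 8j² + 8k² = n} (-1)^k` (Shimura's formula, Thm 1.7, at `n = 1`). This file
PROVES the identity `λ_p = a_p(E)` at the primes `p ≡ 3 (mod 4)` (the supersingular primes of
`E`, where `a_p(E) = 0`, Ireland–Rosen Ch. 18, Thm 5) by an elementary count: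

* `gThetaCoeff_eight_prime_sq` — **`d₈(p²) = 1` for every prime `p ≡ 3 (mod 4)`**: in
  `(4m+1)² + 8(j² + k²) = p²` write `x = 4m + 1`; the terms with `j² + k²` odd cancel under
  `(j, k) ↦ (k, j)` (which changes the parity of `k`), and `j² + k²` even forces `j = k = 0`,
  `x = -p`: indeed `p + x = 4j'`, `j² + k² = j'(p - 2j')`, and for even `j' = 2s > 0` the number
  `2s(p - 4s)` is not a sum of two squares, `p - 4s ≡ 3 (mod 4)` being coprime to `2s`
  (Fermat–Euler, Mathlib `Nat.eq_sq_add_sq_iff`).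
* `heckeTSq_tunnellForm_eight_one_eq_zero` — hence the coefficient of `q¹` of `T(p²)(g θ₈)` is
  `d₈(p²) + (-1/p) = 1 - 1 = 0`, and `tunnellEigenvalues_eq_zero_of_mod_four` — `a_p(E) = 0`
  (`lFunction_congruentNumberCurve_apply_prime_eq_zero`), so `λ_p = a_p(E)` at these primes
  (`heckeTSq_tunnellForm_eight_one_eq_tunnellEigenvalues`).

The ordinary primes `p ≡ 1 (mod 4)` (`λ_p = 2a` with `p = a² + b²`, the genuine content of the
Shimura lift for this form) are not treated. No definitions, no named facts.

## References

* J. B. Tunnell, *A classical Diophantine problem and modular forms of weight 3/2*, Invent. Math.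
  72 (1983) 323–334, proof of Thm 2, pp. 327–328. [Tunnell1983Congruent]
* K. Ireland, M. Rosen, *A Classical Introduction to Modern Number Theory*, GTM 84, Ch. 18 §4
  Thm 5 (`N_p = p + 1` for `p ≡ 3 (mod 4)`). [IrelandRosen1990]
-/

namespace Literature.NumberTheory.EllipticCurves.Tunnell1983

open Finset ModularForms

/-! ### `2s(p - 4s)` is not a sum of two squares -/

/-- Squares are `0` or `1` modulo `4`. [folklore] -/
theorem sq_mod_four (x : ℕ) : x ^ 2 % 4 = 0 ∨ x ^ 2 % 4 = 1 := by
  rcases Nat.even_or_odd x with ⟨r, hr⟩ | ⟨r, hr⟩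
  · left
    rw [hr, show (r + r) ^ 2 = 4 * (r * r) by ring]
    omega
  · right
    rw [hr, show (2 * r + 1) ^ 2 = 4 * (r * r + r) + 1 by ring]
    omega

/-- A natural number `≡ 3 (mod 4)` has a prime factor `≡ 3 (mod 4)` with odd multiplicity
(else it would be a sum of two squares, hence `≢ 3 (mod 4)`). [folklore] -/
theorem exists_prime_mod_four_odd_padicValNat {v : ℕ} (hv : v % 4 = 3) :
    ∃ q ∈ v.primeFactors, q % 4 = 3 ∧ Odd (padicValNat q v) := by
  by_contra h
  simp only [not_exists, not_and] at h
  have hsq : ∃ x y, v = x ^ 2 + y ^ 2 :=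
    Nat.eq_sq_add_sq_iff.mpr fun q hq hq3 ↦ Nat.not_odd_iff_even.mp (h q hq hq3)
  obtain ⟨x, y, hxy⟩ := hsq
  have hx := sq_mod_four x
  have hy := sq_mod_four y
  omega

/-- **`2s(p - 4s)` is not a sum of two squares** for a prime `p` and `0 < s` with `4s < p`,
`p ≡ 3 (mod 4)`: `p - 4s ≡ 3 (mod 4)` has a prime factor `q ≡ 3 (mod 4)` of odd multiplicity, and
`q ∤ 2s` (`q ∣ s` would give `q ∣ p`, `q = p ∣ p - 4s < p`). [folklore] -/
theorem not_sq_add_sq_two_mul_mul_sub {p s : ℕ} (hp : p.Prime) (hp3 : p % 4 = 3) (hs : 0 < s)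
    (h4s : 4 * s < p) (a b : ℕ) : 2 * s * (p - 4 * s) ≠ a ^ 2 + b ^ 2 := by
  intro hab
  set v := p - 4 * s with hv
  have hvpos : 0 < v := by omega
  have hv3 : v % 4 = 3 := by omega
  obtain ⟨q, hq, hq3, hodd⟩ := exists_prime_mod_four_odd_padicValNat hv3
  have hqprime : q.Prime := Nat.prime_of_mem_primeFactors hq
  haveI := Fact.mk hqprime
  have hqv : q ∣ v := Nat.dvd_of_mem_primeFactors hq
  have hw0 : 2 * s * v ≠ 0 := by positivity
  -- `q ∤ 2s`
  have hq2s : ¬ q ∣ 2 * s := by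
    intro hd
    rcases (Nat.Prime.dvd_mul hqprime).mp hd with h2 | hqs
    · have : q ≤ 2 := Nat.le_of_dvd two_pos h2
      omega
    · have hqp : q ∣ p := by
        have : q ∣ v + 4 * s := Nat.dvd_add hqv (Dvd.dvd.mul_left hqs 4)
        rwa [show v + 4 * s = p by omega] at this
      have hq_eq : q = p := (Nat.prime_dvd_prime_iff_eq hqprime hp).mp hqp
      have : p ≤ v := by rw [← hq_eq]; exact Nat.le_of_dvd hvpos hqv
      omega
  have heven : Even (padicValNat q (2 * s * v)) := by
    have hmem : q ∈ (2 * s * v).primeFactors :=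
      Nat.mem_primeFactors.mpr ⟨hqprime, hqv.mul_left _, hw0⟩
    exact Nat.eq_sq_add_sq_iff.mp ⟨a, b, hab⟩ q hmem hq3
  rw [padicValNat.mul (by positivity) hvpos.ne', padicValNat.eq_zero_of_not_dvd hq2s,
    zero_add] at heven
  exact (Nat.not_even_iff_odd.mpr hodd) heven

/-! ### The arithmetic core: `j² + k²` even forces `j = k = 0` -/

/-- **Core lemma.** For a prime `p ≡ 3 (mod 4)` and integers `x ≡ 1 (mod 4)`, `j`, `k` with
`x² + 8(j² + k²) = p²` and `j² + k²` even, `j = k = 0` (and then `x = -p`). Proof: if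
`w = j² + k² > 0` then `|x| < p`, `p + x = 4j'` with `0 < j' < p/2` and `w = j'(p - 2j')`; `w` even
forces `j' = 2s` and `w = 2s(p - 4s)`, not a sum of two squares. [folklore] -/
theorem eq_zero_of_even_of_sq_add {p : ℕ} (hp : p.Prime) (hp3 : p % 4 = 3) {x j k : ℤ}
    (hx : x % 4 = 1) (h : x ^ 2 + 8 * (j ^ 2 + k ^ 2) = (p : ℤ) ^ 2) (he : Even (j ^ 2 + k ^ 2)) :
    j = 0 ∧ k = 0 := by
  by_contra hne
  have hw : 0 < j ^ 2 + k ^ 2 := by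
    rcases not_and_or.mp hne with hj | hk
    · have := sq_pos_of_ne_zero hj; nlinarith [sq_nonneg k]
    · have := sq_pos_of_ne_zero hk; nlinarith [sq_nonneg j]
  have hp3' : (p : ℤ) % 4 = 3 := by exact_mod_cast hp3
  have hppos : (0 : ℤ) < p := by exact_mod_cast hp.pos
  -- `|x| < p`
  have hx2 : x ^ 2 < (p : ℤ) ^ 2 := by nlinarith
  have hxlt : x < p := by nlinarith
  have hxgt : -(p : ℤ) < x := by nlinarith
  -- `p + x = 4 j'`
  have h4 : (4 : ℤ) ∣ p + x := by omega
  obtain ⟨j', hj'⟩ := h4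
  have hj'pos : 0 < j' := by omega
  have hj'lt : 2 * j' < p := by omega
  have hw' : j ^ 2 + k ^ 2 = j' * (p - 2 * j') := by nlinarith
  -- `j'` is even
  have hj'even : Even j' := by
    by_contra hodd
    rw [Int.not_even_iff_odd] at hodd
    have h1 : Odd ((p : ℤ) - 2 * j') := by
      rcases hodd with ⟨r, hr⟩
      exact ⟨(p : ℤ) / 2 - (2 * r + 1), by omega⟩
    have : Odd (j ^ 2 + k ^ 2) := by rw [hw']; exact hodd.mul h1
    exact (Int.not_even_iff_odd.mpr this) he
  obtain ⟨s, hs⟩ := hj'even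
  have hspos : 0 < s := by omega
  have h4s : 4 * s < (p : ℤ) := by omega
  -- pass to `ℕ`
  have key := not_sq_add_sq_two_mul_mul_sub hp hp3 (s := s.toNat) (by omega)
    (by omega) j.natAbs k.natAbs
  apply key
  have e1 : ((j.natAbs ^ 2 + k.natAbs ^ 2 : ℕ) : ℤ) = j ^ 2 + k ^ 2 := by
    push_cast
    rw [sq_abs, sq_abs]
  have e2 : ((2 * s.toNat * (p - 4 * s.toNat) : ℕ) : ℤ) = j' * (p - 2 * j') := by
    have hs0 : (s.toNat : ℤ) = s := Int.toNat_of_nonneg hspos.le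
    have hle : 4 * s.toNat ≤ p := by omega
    push_cast [Nat.cast_sub hle, hs0]
    rw [hs]; ring
  have : ((2 * s.toNat * (p - 4 * s.toNat) : ℕ) : ℤ) = ((j.natAbs ^ 2 + k.natAbs ^ 2 : ℕ) : ℤ) := by
    rw [e1, e2, ← hw']
  exact_mod_cast this

/-! ### `d₈(p²) = 1` for `p ≡ 3 (mod 4)` -/

/-- The sign `(-1)^{|k|}` changes under `(j, k) ↦ (k, j)` when `j² + k²` is odd. [folklore] -/
theorem neg_one_pow_natAbs_add_of_odd {j k : ℤ} (h : Odd (j ^ 2 + k ^ 2)) :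
    (-1 : ℤ) ^ k.natAbs + (-1) ^ j.natAbs = 0 := by
  have hiff : Odd (j ^ 2) ↔ Even (k ^ 2) := Int.odd_add.mp h
  rcases Int.even_or_odd k with hk | hk
  · have hk2 : Even (k ^ 2) := Even.pow_of_ne_zero hk two_ne_zero
    have hj2 : Odd (j ^ 2) := hiff.mpr hk2
    have hj : Odd j := by
      rcases Int.odd_pow.mp hj2 with hj | h0
      · exact hj
      · norm_num at h0
    rw [(Int.natAbs_even.mpr hk).neg_one_pow, (Int.natAbs_odd.mpr hj).neg_one_pow]
    ring
  · have hk2 : Odd (k ^ 2) := Odd.pow hk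
    have hj2 : Even (j ^ 2) := by
      by_contra hne
      exact (Int.not_even_iff_odd.mpr hk2) (hiff.mp (Int.not_even_iff_odd.mp hne))
    have hj : Even j := (Int.even_pow.mp hj2).1
    rw [(Int.natAbs_odd.mpr hk).neg_one_pow, (Int.natAbs_even.mpr hj).neg_one_pow]
    ring

/-- **`d₈(p²) = 1` for every prime `p ≡ 3 (mod 4)`** (the `p²`-th coefficient of
`g θ₈ = ∑ d₈(n) qⁿ`, `d₈(n) = ∑_{8j² + (4m+1)² + 8k² = n} (-1)^k`): the only representation with
`j² + k²` even is `(j, m, k) = (0, -(p+1)/4, 0)` (`eq_zero_of_even_of_sq_add`), and the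
representations with `j² + k²` odd cancel in pairs under `(j, m, k) ↦ (k, m, j)`.
[cite: Tunnell1983Congruent, proof of Thm 2, pp. 327–328] -/
theorem gThetaCoeff_eight_prime_sq {p : ℕ} (hp : p.Prime) (hp3 : p % 4 = 3) :
    gThetaCoeff 8 ((p : ℤ) ^ 2) = 1 := by
  classical
  rw [gThetaCoeff_eq_sum_thetaRep (by norm_num), Nat.cast_ofNat]
  set S := thetaRep 8 8 ((p : ℤ) ^ 2) with hS
  have hmem : ∀ q : ℤ × ℤ × ℤ, q ∈ S ↔ 8 * q.1 ^ 2 + (4 * q.2.1 + 1) ^ 2 + 8 * q.2.2 ^ 2 = (p : ℤ) ^ 2 :=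
    fun q ↦ mem_thetaRep (by norm_num) (by norm_num)
  set P : ℤ × ℤ × ℤ → Prop := fun q ↦ Odd (q.1 ^ 2 + q.2.2 ^ 2) with hP
  rw [← Finset.sum_filter_add_sum_filter_not S P]
  -- the odd part cancels
  have hodd : ∑ q ∈ S.filter P, (-1 : ℤ) ^ q.2.2.natAbs = 0 := by
    refine Finset.sum_involution (fun q _ ↦ (q.2.2, q.2.1, q.1)) ?_ ?_ ?_ ?_
    · intro q hq
      rw [Finset.mem_filter] at hq
      exact neg_one_pow_natAbs_add_of_odd hq.2
    · intro q hq _ heq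
      rw [Finset.mem_filter] at hq
      have h1 : q.2.2 = q.1 := congrArg Prod.fst heq
      have h2 : Odd (q.1 ^ 2 + q.2.2 ^ 2) := hq.2
      have : Odd (q.1 ^ 2 + q.1 ^ 2) := by rwa [h1] at h2
      exact (Int.not_even_iff_odd.mpr this) ⟨q.1 ^ 2, rfl⟩
    · intro q hq
      rw [Finset.mem_filter] at hq ⊢
      refine ⟨(hmem _).mpr ?_, ?_⟩
      · have := (hmem q).mp hq.1
        simp only
        linarith
      · simp only [hP] at hq ⊢
        rw [add_comm]
        exact hq.2
    · intro q hq
      rfl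
  -- the even part is the single term `(0, -(p+1)/4, 0)`
  set m₀ : ℤ := -(((p : ℤ) + 1) / 4) with hm₀
  have hm₀' : 4 * m₀ + 1 = -(p : ℤ) := by
    have : (p : ℤ) % 4 = 3 := by exact_mod_cast hp3
    omega
  have heven : S.filter (fun q ↦ ¬ P q) = {((0 : ℤ), m₀, (0 : ℤ))} := by
    ext q
    simp only [Finset.mem_filter, Finset.mem_singleton, hP, ← Int.not_even_iff_odd, not_not]
    constructor
    · rintro ⟨hq, he⟩
      have h := (hmem q).mp hq
      have hx : (4 * q.2.1 + 1) % 4 = 1 := by omega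
      obtain ⟨hj, hk⟩ := eq_zero_of_even_of_sq_add hp hp3 (x := 4 * q.2.1 + 1) (j := q.1)
        (k := q.2.2) hx (by linarith) he
      rw [hj, hk] at h
      have hsq : (4 * q.2.1 + 1) ^ 2 = (p : ℤ) ^ 2 := by linarith
      have hx' : 4 * q.2.1 + 1 = -(p : ℤ) := by
        rcases sq_eq_sq_iff_eq_or_eq_neg.mp hsq with h1 | h1
        · -- `4 q + 1 = p` contradicts `p ≡ 3 (mod 4)`
          exfalso
          have : (p : ℤ) % 4 = 3 := by exact_mod_cast hp3
          omega
        · exact h1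
      have hm : q.2.1 = m₀ := by omega
      rcases q with ⟨j, m, k⟩
      simp only at hj hk hm
      simp [hj, hk, hm]
    · rintro rfl
      refine ⟨(hmem _).mpr ?_, ⟨0, by simp⟩⟩
      simp only
      rw [hm₀']
      ring
  rw [hodd, heven, Finset.sum_singleton, zero_add]
  simp

/-- **`d₈(p²) = 1` for primes `p ≡ 3 (mod 4)`**, for the sibling's `formCoeff`. [folklore] -/
theorem formCoeff_eight_prime_sq {p : ℕ} (hp : p.Prime) (hp3 : p % 4 = 3) :
    formCoeff 8 (p ^ 2) = 1 := by
  rw [formCoeff_eq_gThetaCoeff (by norm_num)]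
  push_cast
  exact gThetaCoeff_eight_prime_sq hp hp3

/-! ### The eigenvalue `λ_p(g θ₈) = d₈(p²) + (-1/p)` vanishes at `p ≡ 3 (mod 4)`, as does `a_p(E)` -/

/-- `(-1/p) = -1` for a prime `p ≡ 3 (mod 4)`. [folklore] -/
theorem jacobiSym_neg_one_of_mod_four {p : ℕ} (hp : p.Prime) (hp3 : p % 4 = 3) :
    jacobiSym (-1) p = -1 := by
  rw [jacobiSym.at_neg_one (hp.odd_of_ne_two (by omega)), ZMod.χ₄_nat_three_mod_four hp3]

/-- **The coefficient of `q¹` of `T(p²)(g θ₈)` vanishes for primes `p ≡ 3 (mod 4)`**: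
by Shimura's formula it is `d₈(p²) + χ(p)(-1/p) d₈(1) = 1 - 1 = 0` (trivial character).
This is the `T(p²)`-eigenvalue of the eigenform `g θ₈`. [cite: Tunnell1983Congruent, proof of Thm 2, pp. 327–328] -/
theorem heckeTSq_tunnellForm_eight_one_eq_zero {p : ℕ} (hp : p.Prime) (hp3 : p % 4 = 3) :
    heckeTSq 3 (1 : DirichletCharacter ℂ 128) p (qCoeffs (tunnellForm 8)) 1 = 0 := by
  have hp2 : p ≠ 2 := by omega
  have hunit : IsUnit ((p : ℕ) : ZMod 128) := by
    rw [ZMod.isUnit_iff_coprime]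
    exact Nat.Coprime.pow_right 7 ((Nat.coprime_primes hp Nat.prime_two).mpr hp2)
  have hndvd : ¬ p ^ 2 ∣ 1 := by
    intro h
    have h1 : p ^ 2 ≤ 1 := Nat.le_of_dvd one_pos h
    nlinarith [hp.two_le]
  rw [heckeTSq_three_apply, qCoeffs_tunnellForm (by norm_num : 0 < 8), if_neg hndvd]
  simp only [mul_one, Nat.cast_one, mul_zero, add_zero, MulChar.one_apply hunit, one_mul]
  have h1 : (formCoeff 8 1 : ℂ) = 1 := by
    rw [formCoeff_eq_gThetaCoeff (by norm_num)]
    exact_mod_cast (by decide +kernel : gThetaCoeff 8 ((1 : ℕ) : ℤ) = 1)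
  rw [h1, jacobiSym_neg_one_of_mod_four hp hp3, formCoeff_eight_prime_sq hp hp3]
  push_cast
  ring

/-- **`a_p(E) = 0` at the primes `p ≡ 3 (mod 4)`** for `E : y² = x³ - x` (`tunnellEigenvalues`;
Ireland–Rosen Ch. 18, Thm 5: `N_p = p + 1`). [cite: IrelandRosen1990, Ch. 18 §4, Theorem 5] -/
theorem tunnellEigenvalues_eq_zero_of_mod_four {p : ℕ} (hp : p.Prime) (hp3 : p % 4 = 3) :
    tunnellEigenvalues p = 0 := by
  rw [tunnellEigenvalues, lFunction_congruentNumberCurve_apply_prime_eq_zero hp hp3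
    (by intro h; have := Nat.le_of_dvd one_pos h; have := hp.two_le; omega)]
  simp

/-- **The supersingular half of the Shimura–Niwa input for `g θ₈`**: at every prime
`p ≡ 3 (mod 4)` the `T(p²)`-eigenvalue `d₈(p²) + (-1/p)` of `g θ₈` equals `a_p(E)` (both are `0`).
[cite: Tunnell1983Congruent, proof of Thm 2, pp. 327–328] -/
theorem heckeTSq_tunnellForm_eight_one_eq_tunnellEigenvalues {p : ℕ} (hp : p.Prime)
    (hp3 : p % 4 = 3) :
    heckeTSq 3 (1 : DirichletCharacter ℂ 128) p (qCoeffs (tunnellForm 8)) 1 = tunnellEigenvalues p := by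
  rw [heckeTSq_tunnellForm_eight_one_eq_zero hp hp3, tunnellEigenvalues_eq_zero_of_mod_four hp hp3]

end Literature.NumberTheory.EllipticCurves.Tunnell1983
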